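import Mathlib
import Summits.Ventures.HodgeRepro.Tier4.Target
import Summits.Ventures.HodgeRepro.Tier4.Line3.KMDatum
import Summits.Ventures.HodgeRepro.Tier4.Line3.KMDatumS
import Summits.Ventures.HodgeRepro.Tier4.Line3.Defs
import Summits.Ventures.HodgeRepro.Tier4.Line3.DefsLemmas
import Summits.Ventures.HodgeRepro.Tier4.Line3.HeckeEquivarianceLemmas
import Summits.Ventures.HodgeRepro.Tier4.Line3.LocSScalarObstructionGen

/-!
# Tier4/Line3/UnitCopyScaling — the summand at a per-slot scalar copy `ε • x`: a phase times a non-negative multiple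

Blind re-derivation cell `pub-hodge-repro`, Tier 4 «PROVE THE STEP», LINE L3, seat t4-L3-p2 (g2); bus S13495 (1).  The repaired
line (plan-3 g3 S13492) sums the main term over the per-slot scalar copies `ε • xm` of the main orbit; this module records what the
tree's definitions give at such a copy, with NO unfolding and NO hypothesis beyond the per-slot scalar symmetry of the data:

* the archimedean datum scales by a POSITIVE REAL under every complex scalar (`maj_smul_complex`, `datumS_smul_complex`: `datumS` is
  a sesquilinear form times the Gaussian of the majorant), so the quadruple kernel at `ε • x` is a positive real multiple of the
  kernel at `x` (`kernel_smul_family`);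
* under the per-slot scalar symmetry `SlotScalarSymmetric D j (ε j) (lam j)` (p679303) the quadruple coefficient at `ε • x` is
  `lam 0 · lam 1 · conj (lam 2 · lam 3)` times a positive real multiple of the coefficient at `x` (`coefQ_smul_family`);
* hence the summand at `ε • x` is `Λ(ε) := lam 0 · lam 1 · conj (lam 2 · lam 3)` times a NON-NEGATIVE real multiple of the summand
  at `x` (`summand_smul_family`): the phase of the copy is the archimedean phase `Λ(ε)` and nothing else.

Nothing here says anything about the status of the Hodge conjecture for CM abelian varieties, which is NOT proved
(HC_CM is NOT proved by anyone in this repository).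
-/

set_option autoImplicit false

noncomputable section

namespace Summit.Ventures.HodgeRepro.Tier4.Line3

open Summit.Ventures.HodgeRepro.Tier4
open Matrix NumberField
open scoped ComplexConjugate

/-! ### 1. The archimedean datum under complex scalars -/

/-- The majorant is hermitian-quadratic in `y`: `maj (c • y) z = ‖c‖² maj y z`. -/
theorem maj_smul_complex (c : ℂ) (y : Fin 3 → ℂ) (z : Fin 2 → ℂ) : maj (c • y) z = ‖c‖ ^ 2 * maj y z := by
  unfold maj
  have h1 : star (c • y) ⬝ᵥ (J *ᵥ (c • y)) = (‖c‖ ^ 2 : ℝ) * (star y ⬝ᵥ (J *ᵥ y)) := by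
    rw [star_smul, Matrix.mulVec_smul, smul_dotProduct, dotProduct_smul, smul_eq_mul, smul_eq_mul, ← mul_assoc,
      Complex.star_def, Complex.conj_mul', Complex.ofReal_pow]
  have h2 : ‖star (lift3 z) ⬝ᵥ (J *ᵥ (c • y))‖ = ‖c‖ * ‖star (lift3 z) ⬝ᵥ (J *ᵥ y)‖ := by
    rw [Matrix.mulVec_smul, dotProduct_smul, smul_eq_mul, norm_mul]
  rw [h1, h2, Complex.re_ofReal_mul, mul_pow]
  ring

/-- The datum scales by the positive real `‖c‖² exp(−π(‖c‖² − 1) maj y z)` under a complex scalar `c`. -/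
theorem datumS_smul_complex (Φ : KMDatumS) (c : ℂ) (y : Fin 3 → ℂ) (z : Fin 2 → ℂ) (k : Fin 2) :
    datumS Φ (c • y) z k =
      ((‖c‖ ^ 2 * Real.exp (-(Real.pi * ((‖c‖ ^ 2 - 1) * maj y z))) : ℝ) : ℂ) * datumS Φ y z k := by
  unfold datumS
  rw [maj_smul_complex, star_smul, Matrix.mulVec_smul, smul_dotProduct, dotProduct_smul, smul_eq_mul, smul_eq_mul,
    ← mul_assoc, Complex.star_def, Complex.conj_mul']
  have hexp : Real.exp (-Real.pi * (‖c‖ ^ 2 * maj y z)) =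
      Real.exp (-(Real.pi * ((‖c‖ ^ 2 - 1) * maj y z))) * Real.exp (-Real.pi * maj y z) := by
    rw [← Real.exp_add]; ring_nf
  rw [hexp]
  push_cast
  ring

/-- The scaling factor of the datum is positive. -/
theorem datum_scale_pos {c : ℂ} (hc : c ≠ 0) (y : Fin 3 → ℂ) (z : Fin 2 → ℂ) :
    0 < ‖c‖ ^ 2 * Real.exp (-(Real.pi * ((‖c‖ ^ 2 - 1) * maj y z))) :=
  mul_pos (pow_pos (norm_pos_iff.2 hc) 2) (Real.exp_pos _)

namespace T4Data

variable (X : T4Data)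

/-- The scaling factor of the quadruple kernel at a per-slot scalar copy `ε • x`. -/
def kernelScale (ε : Fin 4 → X.E) (x : X.Tuple) (z : Fin 2 → ℂ) : ℝ :=
  ∏ j, (‖X.τ₀ (ε j)‖ ^ 2 * Real.exp (-(Real.pi * ((‖X.τ₀ (ε j)‖ ^ 2 - 1) * maj (X.ballCoord (x j)) z))))

/-- The kernel scaling factor is non-negative. -/
theorem kernelScale_nonneg (ε : Fin 4 → X.E) (x : X.Tuple) (z : Fin 2 → ℂ) : 0 ≤ X.kernelScale ε x z :=
  Finset.prod_nonneg fun _ _ => mul_nonneg (pow_nonneg (norm_nonneg _) 2) (Real.exp_pos _).le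

/-- **THE KERNEL AT A PER-SLOT SCALAR COPY** is a non-negative real multiple of the kernel at `x`. -/
theorem kernel_smul_family (Φ : KMDatumS) (ε : Fin 4 → X.E) (x : X.Tuple) (z : Fin 2 → ℂ) :
    X.kernel Φ (fun j => ε j • x j) z = (X.kernelScale ε x z : ℂ) * X.kernel Φ x z := by
  have hd : ∀ (j : Fin 4) (k : Fin 2), datumS Φ (X.ballCoord (ε j • x j)) z k =
      ((‖X.τ₀ (ε j)‖ ^ 2 * Real.exp (-(Real.pi * ((‖X.τ₀ (ε j)‖ ^ 2 - 1) * maj (X.ballCoord (x j)) z))) : ℝ) : ℂ) *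
        datumS Φ (X.ballCoord (x j)) z k :=
    fun j k => by rw [X.ballCoord_smul]; exact datumS_smul_complex Φ _ _ z k
  unfold T4Data.kernel kernelScale wedge
  rw [hd 0 0, hd 0 1, hd 1 0, hd 1 1, hd 2 0, hd 2 1, hd 3 0, hd 3 1, Fin.prod_univ_four]
  simp only [map_mul, map_sub, Complex.conj_ofReal]
  push_cast
  ring

/-! ### 2. The coefficient and the summand at a per-slot scalar copy -/

/-- The Gaussian ratio of a per-slot scalar copy. -/
def gaussRatio (ε : Fin 4 → X.E) (x : X.Tuple) : ℝ :=
  ∏ j, (X.gaussDef (ε j • x j) / X.gaussDef (x j))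

/-- The Gaussian ratio is positive. -/
theorem gaussRatio_pos (ε : Fin 4 → X.E) (x : X.Tuple) : 0 < X.gaussRatio ε x :=
  Finset.prod_pos fun _ _ => div_pos (X.gaussDef_pos _) (X.gaussDef_pos _)

/-- **THE COEFFICIENT AT A PER-SLOT SCALAR COPY** under the per-slot scalar symmetries: the phase
`lam 0 · lam 1 · conj (lam 2 · lam 3)` times the positive Gaussian ratio times the coefficient at `x`. -/
theorem coefQ_smul_family (D : X.ThetaData) {ε : Fin 4 → X.E} {lam : Fin 4 → ℂ}
    (hu : ∀ j, X.SlotScalarSymmetric D j (ε j) (lam j)) {K : X.Level} (γ : X.Tr K) (x : X.Tuple) :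
    X.coefQ D.cf γ (fun j => ε j • x j) =
      lam 0 * lam 1 * conj (lam 2 * lam 3) * ((X.gaussRatio ε x : ℂ) * X.coefQ D.cf γ x) := by
  have hg : ∀ j, (X.gaussDef (x j) : ℂ) ≠ 0 := fun j => Complex.ofReal_ne_zero.2 (X.gaussDef_pos _).ne'
  have key : X.coefQ D.cf γ (fun j => ε j • x j) * ∏ j, (X.gaussDef (x j) : ℂ) =
      lam 0 * lam 1 * conj (lam 2 * lam 3) * (X.coefQ D.cf γ x * ∏ j, (X.gaussDef (ε j • x j) : ℂ)) := by
    unfold T4Data.coefQ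
    rw [Finsupp.sum_mul, Finsupp.sum_mul, Finsupp.mul_sum]
    refine Finsupp.sum_congr fun h _ => ?_
    simp only [Fin.prod_univ_four]
    exact quad_transport_lam (X.heckeAct_smul_of_slotScalarSymmetric D (hu 0) K (h.2 (X.slot 0)) (x 0))
      (X.heckeAct_smul_of_slotScalarSymmetric D (hu 1) K (h.2 (X.slot 1)) (x 1))
      (X.heckeAct_smul_of_slotScalarSymmetric D (hu 2) K (h.2 (X.slot 2)) (x 2))
      (X.heckeAct_smul_of_slotScalarSymmetric D (hu 3) K (h.2 (X.slot 3)) (x 3))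
  have hprod : (∏ j, (X.gaussDef (x j) : ℂ)) ≠ 0 := Finset.prod_ne_zero_iff.2 fun j _ => hg j
  have hratio : (X.gaussRatio ε x : ℂ) = (∏ j, (X.gaussDef (ε j • x j) : ℂ)) / ∏ j, (X.gaussDef (x j) : ℂ) := by
    unfold gaussRatio
    push_cast
    rw [Finset.prod_div_distrib]
  rw [eq_div_of_mul_eq hprod key, hratio]
  ring

/-- **THE SUMMAND AT A PER-SLOT SCALAR COPY**: `Λ(ε)` times a NON-NEGATIVE real multiple of the summand at `x`. -/
theorem summand_smul_family (D : X.ThetaData) {ε : Fin 4 → X.E} {lam : Fin 4 → ℂ}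
    (hu : ∀ j, X.SlotScalarSymmetric D j (ε j) (lam j)) {K : X.Level} (γ : X.Tr K) (x : X.Tuple) (z : Fin 2 → ℂ) :
    X.coefQ D.cf γ (fun j => ε j • x j) * X.kernel D.Φ (fun j => ε j • x j) z =
      lam 0 * lam 1 * conj (lam 2 * lam 3) *
        (((X.gaussRatio ε x * X.kernelScale ε x z : ℝ) : ℂ) * (X.coefQ D.cf γ x * X.kernel D.Φ x z)) := by
  rw [X.coefQ_smul_family D hu γ x, X.kernel_smul_family D.Φ ε x z]
  push_cast
  ring

/-- The real factor of `summand_smul_family` is non-negative. -/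
theorem gaussRatio_mul_kernelScale_nonneg (ε : Fin 4 → X.E) (x : X.Tuple) (z : Fin 2 → ℂ) :
    0 ≤ X.gaussRatio ε x * X.kernelScale ε x z :=
  mul_nonneg (X.gaussRatio_pos ε x).le (X.kernelScale_nonneg ε x z)

end T4Data

end Summit.Ventures.HodgeRepro.Tier4.Line3

end
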